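import Summits.CriticalPhenomena.PercolationContinuityZ3.Theorems.PercNearOneGluingNoHeavyLowerTailQ44bPencilBase
import HarnessLib

/-!
# `Q44b` for every finite weighted graph from ONE second-order inequality at the terminal `a` (the stripping reduction)

Support file for crux `stmt-CriticalPhenomena-4575` (master-family programme, quadratic four-point row `Q44b` of
`prim-bnk-1` gen 13, OPEN for all `n`), seat `prim-l12-p6` gen 8; memo
`run/shared/lean/prim/prim-l12/FROM-prim-l12-p6-g8-Q44B-MIXED-BERNSTEIN.md` §3–§4.

Gen 7 reduced `Q44b ≥ 0` (all weightings) to pencil concavity `ND_a` (`Q44b.row_nonneg_of_pencilConcave`):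
along the pencil of a pair `e = s(x,z)` at `a`'s sure cluster the concavity gap `ndGap w e = B₀₁ + B₁₀ − B₀ − B₂`
(`…Q44bPencilBase.lean`) should be `≥ 0`.  Here we reduce `ND_a` one level further.

* `Q44b.ndGap_twoBond` — as a function of the weight `t` of ANY OTHER pair `g`, the gap is the quadratic
  `(1−t)²·ndGap(w[g↦0]) + t(1−t)·crossGap(w;e,g) + t²·ndGap(w[g↦1])` (two one-bond expansions and `ring`);
  `crossGap` is the sum of the two "doubly mixed" blocks (`e` mixed, `g` mixed).
* `Q44b.TC1a` — HYPOTHESIS `TC₁`: `0 ≤ crossGap w s(x,z) s(x',u)` whenever `x, x'` are surely joined to `a` and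
  `s(x',u)` is fractional (memo §4: 0 violations in 3·123 216 exhaustive instances on ≤ 6 vertices and 40 068 random
  ones on ≤ 8 vertices; the analogous statement for pairs `g` NOT at `a`'s cluster is false).
* `Q44b.nda_of_tc1a` — **the stripping reduction** `TC1a → NDa` (induction on the number of fractional pairs:
  strip the fractional pairs at `a`'s sure cluster other than `e` one at a time by `ndGap_twoBond`; the three
  coefficients are nonnegative by induction and by `TC1a`; when none is left, `ndGap_nonneg_base`), and
  `Q44b.row_nonneg_of_tc1a : TC1a n a b c y → ∀ w, 0 ≤ Q44b.row w a b c y` (with gen 7's reduction).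

Definitions (`upd2`, `ndMixed`, `crossGap`, `TC1a`) and theorems; no named facts, no sorries, standard axioms.
-/

noncomputable section

namespace Summit.CriticalPhenomena.PercolationContinuityZ3.Theorems

namespace Q44b

open MeasureTheory Set Literature.Probability.LatticeModels Literature.Probability.Percolation
open scoped Classical

variable {n : ℕ}

/-! ### The two-bond expansion of the gap -/

/-- The weighting `w` with `e ↦ α` and then `g ↦ β`. [this work] -/
def upd2 (w : Sym2 (Fin n) → unitInterval) (e g : Sym2 (Fin n)) (α β : unitInterval) :
    Sym2 (Fin n) → unitInterval :=
  Function.update (Function.update w e α) g β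

/-- The block `N(β,β')` of the gap along `e` with the second pair `g` frozen at `β` in the first copy and at `β'`
in the second copy. [this work] -/
def ndMixed (w : Sym2 (Fin n) → unitInterval) (e g : Sym2 (Fin n)) (β β' : unitInterval)
    (a b c y : Fin n) : ℝ :=
  bil (upd2 w e g 0 β) (upd2 w e g 1 β') a b c y + bil (upd2 w e g 1 β) (upd2 w e g 0 β') a b c y -
    bil (upd2 w e g 0 β) (upd2 w e g 0 β') a b c y - bil (upd2 w e g 1 β) (upd2 w e g 1 β') a b c y

/-- The doubly-mixed coefficient `crossGap(w; e, g) = N(0,1) + N(1,0)`: the coefficient of `t(1−t)` in the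
two-bond expansion of the gap along `e` in the weight `t` of `g`. [this work] -/
def crossGap (w : Sym2 (Fin n) → unitInterval) (e g : Sym2 (Fin n)) (a b c y : Fin n) : ℝ :=
  ndMixed w e g 0 1 a b c y + ndMixed w e g 1 0 a b c y

/-- **Two-bond expansion of the gap.**  For `g ≠ e` and `t = w g`:
`ndGap w e = (1−t)² ndGap (w[g↦0]) e + t(1−t) crossGap w e g + t² ndGap (w[g↦1]) e`. [this work] -/
theorem ndGap_twoBond (w : Sym2 (Fin n) → unitInterval) {e g : Sym2 (Fin n)} (hge : g ≠ e) (a b c y : Fin n) :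
    ndGap w e a b c y =
      (1 - (w g : ℝ)) * (1 - (w g : ℝ)) * ndGap (Function.update w g 0) e a b c y +
        (w g : ℝ) * (1 - (w g : ℝ)) * crossGap w e g a b c y +
        (w g : ℝ) * (w g : ℝ) * ndGap (Function.update w g 1) e a b c y := by
  have key : ∀ (α : unitInterval) (E : Set (BondConfig (Fin n))),
      (prodBernoulli (Function.update w e α)).real E =
        (1 - (w g : ℝ)) * (prodBernoulli (upd2 w e g α 0)).real E +
          (w g : ℝ) * (prodBernoulli (upd2 w e g α 1)).real E := by
    intro α E
    have h := TieLocus.real_oneBond (Function.update w e α) g E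
    rwa [Function.update_of_ne hge] at h
  have comm : ∀ (α β : unitInterval), Function.update (Function.update w g β) e α = upd2 w e g α β :=
    fun α β => Function.update_comm hge β α w
  unfold ndGap crossGap ndMixed
  simp only [comm]
  unfold bil
  rw [key 0 (evAC a b c y), key 0 (evEmp a b c y), key 0 (evAD a b c y), key 0 (evX a b c y),
    key 0 (evAB a b c y), key 0 (evCnA a b c y), key 0 (evPend a b c y), key 0 (evXp a b c y),
    key 1 (evAC a b c y), key 1 (evEmp a b c y), key 1 (evAD a b c y), key 1 (evX a b c y),
    key 1 (evAB a b c y), key 1 (evCnA a b c y), key 1 (evPend a b c y), key 1 (evXp a b c y)]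
  ring

/-- **Hypothesis `TC₁` at `a`** (memo §4): for every weighting, every pair `s(x,z)` and every FRACTIONAL pair
`s(x',u) ≠ s(x,z)` with `x, x'` surely joined to `a` (after both pairs are deleted), the doubly-mixed coefficient
is nonnegative.  Equivalently: the mixed Bernstein coefficient `B₀₁+B₁₀` of the pencil along `s(x,z)` is a
CONCAVE function of the weight of `s(x',u)`. [this work] -/
def TC1a (n : ℕ) (a b c y : Fin n) : Prop :=
  ∀ (w : Sym2 (Fin n) → unitInterval) (x z x' u : Fin n), x ≠ z → x' ≠ u → s(x', u) ≠ s(x, z) →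
    sureJoined (Function.update (Function.update w s(x, z) 0) s(x', u) 0) a x →
    sureJoined (Function.update (Function.update w s(x, z) 0) s(x', u) 0) a x' →
    (w s(x', u) ≠ 0 ∧ w s(x', u) ≠ 1) →
      0 ≤ crossGap w s(x, z) s(x', u) a b c y

/-! ### The stripping induction -/

/-- **`TC₁ ⇒ ND_a`.**  Strip the fractional pairs at `a`'s sure cluster other than the pencil pair one at a time
(`ndGap_twoBond`; the three coefficients are nonnegative by induction and by `TC1a`); when none is left,
`ndGap_nonneg_base`. [this work] -/
theorem nda_of_tc1a (a b c y : Fin n) (hT : TC1a n a b c y) : NDa n a b c y := by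
  suffices H : ∀ (k : ℕ) (w : Sym2 (Fin n) → unitInterval), (fracPairs w).card ≤ k →
      ∀ x z : Fin n, x ≠ z → sureJoined (Function.update w s(x, z) 0) a x → 0 ≤ ndGap w s(x, z) a b c y by
    intro w x z hxz hs
    exact (pencilConcave_iff_ndGap w s(x, z) a b c y).2 (H _ w le_rfl x z hxz hs)
  intro k
  induction k with
  | zero =>
    intro w hw x z hxz hs
    refine ndGap_nonneg_base w a b c y x z hs ?_
    intro x' u hx'u _ _
    by_contra hne
    push Not at hne
    have : s(x', u) ∈ fracPairs w := by
      simp only [fracPairs, Finset.mem_filter, Finset.mem_univ, true_and]; exact hne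
    have hpos : 0 < (fracPairs w).card := Finset.card_pos.2 ⟨_, this⟩
    omega
  | succ k ih =>
    intro w hw x z hxz hs
    by_cases hex : ∃ x' u : Fin n, x' ≠ u ∧ s(x', u) ≠ s(x, z) ∧
        sureJoined (Function.update w s(x, z) 0) a x' ∧ (w s(x', u) ≠ 0 ∧ w s(x', u) ≠ 1)
    · obtain ⟨x', u, hx'u, hge, hs', hfrac⟩ := hex
      set g : Sym2 (Fin n) := s(x', u) with hg
      have hlt0 := Finset.card_lt_card (fracPairs_update_ssubset w hfrac 0 (Or.inl rfl))
      have hlt1 := Finset.card_lt_card (fracPairs_update_ssubset w hfrac 1 (Or.inr rfl))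
      -- sure joins at the two ends of the `g`-pencil
      have hs0 : sureJoined (Function.update (Function.update w g 0) s(x, z) 0) a x := by
        rw [Function.update_comm hge]
        exact sureJoined_update_zero _ (by rw [Function.update_of_ne hge]; exact hfrac.2) hs
      have hs1 : sureJoined (Function.update (Function.update w g 1) s(x, z) 0) a x := by
        rw [Function.update_comm hge]
        exact sureJoined_update_one _ g hs
      have h0 : 0 ≤ ndGap (Function.update w g 0) s(x, z) a b c y := ih _ (by omega) x z hxz hs0
      have h1 : 0 ≤ ndGap (Function.update w g 1) s(x, z) a b c y := ih _ (by omega) x z hxz hs1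
      have hc : 0 ≤ crossGap w s(x, z) g a b c y := by
        refine hT w x z x' u hxz hx'u hge ?_ ?_ hfrac
        · exact sureJoined_update_zero _ (by rw [Function.update_of_ne hge]; exact hfrac.2) hs
        · exact sureJoined_update_zero _ (by rw [Function.update_of_ne hge]; exact hfrac.2) hs'
      rw [ndGap_twoBond w hge]
      set t : ℝ := (w g : ℝ)
      have ht0 : 0 ≤ t := unitInterval.nonneg (w g)
      have ht1 : t ≤ 1 := unitInterval.le_one (w g)
      have h1t : 0 ≤ 1 - t := by linarith
      have := mul_nonneg (mul_nonneg h1t h1t) h0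
      have := mul_nonneg (mul_nonneg ht0 h1t) hc
      have := mul_nonneg (mul_nonneg ht0 ht0) h1
      linarith
    · push Not at hex
      refine ndGap_nonneg_base w a b c y x z hs ?_
      intro x' u hx'u hge hs'
      by_cases h0 : w s(x', u) = 0
      · exact Or.inl h0
      · exact Or.inr (hex x' u hx'u hge hs' h0)

/-- **`TC₁ ⇒ Q44b` for every weighting** (with gen 7's `row_nonneg_of_pencilConcave`). [this work] -/
theorem row_nonneg_of_tc1a (a b c y : Fin n) (hT : TC1a n a b c y) (w : Sym2 (Fin n) → unitInterval) :
    0 ≤ row w a b c y :=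
  row_nonneg_of_pencilConcave a b c y (nda_of_tc1a a b c y hT) w

end Q44b

end Summit.CriticalPhenomena.PercolationContinuityZ3.Theorems

end
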